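import Literature.Geometry.Lorentzian.CarterThresholdTurningPoint
import Literature.Geometry.Lorentzian.KerrTortoiseRadiusSurj
import HarnessLib

/-!
# The far turning point of the threshold barrier in the tortoise variable: affine two-sided control
# of Carter's coefficient on the last stretch before `b₂`
(namespace `Literature.Geometry.Lorentzian.Kerr`.)

Continuation of `CarterThresholdTurningPoint.lean` (radial statements: the `r`-form turning point `r_t`
of the threshold profile `J`, the true turning point `r_b ≥ r_t` with `ω²(r_t + r₊)(r_b − r_t) ≤ 3`, and
`Δ(r)(2ω²(r + r₊)h(r)(r_t − r) − 3) ≤ (r² + a²)²(V − ω²) ≤ Δ(r)(C_t(r)(r_b − r) + 3)`). Along a tortoise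
radius `ρ` (`ρ′ = Δ(ρ)/(ρ² + a²)`, strictly increasing) the radial distance to the turning point
`r_b = ρ b₂` is comparable to the tortoise distance `b₂ − s` with EXPLICIT factors on any stretch
`[s_lo, b₂]` (`ρ s_lo = r_lo > r₊`):

* `IsTortoiseRadius.mul_sub_le_sub`, `IsTortoiseRadius.sub_le_mul_sub'` — for `x ≤ y`:
  `Δ(ρ x)/(ρ y² + a²)·(y − x) ≤ ρ y − ρ x ≤ Δ(ρ y)/(ρ x² + a²)·(y − x)` (`Δ` is increasing beyond `M`);
* `negCoeff_affine_bounds_tortoise_of_threshold` — at the threshold `ω = mω₊ ≠ 0`, for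
  `s ∈ [s_lo, b₂]` (`V(ρ b₂) = ω²`, `J(r_t) = 0`, `r_t − r₊ ≥ r₊ − r₋`):
  `c₁·(b₂ − s) − e₁ ≤ V(ρ s) − ω² ≤ c₂·(b₂ − s) + e₂` with
  `c₁ = 2ω²(r_lo + r₊)h(r_lo)Δ(r_lo)²/(r_b² + a²)³`, `e₁ = Δ(r_b)(6(r_b + r₊)/(r_t + r₊) + 3)/(r_lo² + a²)²`,
  `c₂ = ω²(2(r_t + r₊) + (r_t + r₊)²/(r_lo − r₋))·Δ(r_b)²/(r_lo² + a²)³`, `e₂ = 3Δ(r_b)/(r_lo² + a²)²`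
  (`h = (r − r₊)/(r − r₋)`).

With `r_lo` a κ-free fraction of the way from `r₊` to `r_b` (the threshold barrier ends a κ-free
distance beyond the horizon, `CarterThresholdBarrier.le_rho_of_forbidden_threshold`), all four constants
are monomials in `Λ, |ω|^{±1}, M^{±1}` — the input of `TurningPointEndgame.norm_le_of_affine_coeff`
(last Airy length, `L³c₂ ≤ 1`) and of the window/maximum-principle step of the threshold tunnelling
estimate (near-extremal Kerr programme, crux `KappaExplicitWaveDecay`). Not here: the choice of `L`.

## References
* M. Dafermos, I. Rodnianski, Y. Shlapentokh-Rothman, arXiv:1402.7034 = Ann. of Math. 183 (2016),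
  §§2.1.2, 5.2.3, 6.2 (key `DafermosRodnianskiShlapentokhrothman2014`). The assembly is folklore.
-/

noncomputable section

open Set

namespace Literature.Geometry.Lorentzian

namespace Kerr

/-! ### Radial versus tortoise distances along `ρ` -/

namespace IsTortoiseRadius

variable {M a : ℝ} {ρ : ℝ → ℝ}

/-- `Δ` is non-decreasing on `[r₊, ∞)` (`Δ′ = 2(r − M) ≥ 0` there). [folklore] -/
theorem delta_le_delta (hMa : IsSubextremal M a) {x y : ℝ} (hx : rPlus M a ≤ x) (hxy : x ≤ y) :
    delta M a x ≤ delta M a y := by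
  have hM : 0 < M := hMa.pos
  have hMx : M ≤ x := (M_le_rPlus M a).trans hx
  unfold delta
  nlinarith

/-- **Lower comparison of radial and tortoise distances**: for a tortoise radius `ρ` and `x ≤ y`,
`Δ(ρ x)/(ρ y² + a²)·(y − x) ≤ ρ y − ρ x` (`ρ′ = Δ(ρ)/(ρ² + a²) ≥ Δ(ρ x)/(ρ y² + a²)` on `[x, y]`).
[cite: DafermosRodnianskiShlapentokhrothman2014, §2.1.2] -/
theorem mul_sub_le_sub (hρ : IsTortoiseRadius M a ρ) (hMa : IsSubextremal M a) {x y : ℝ}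
    (hxy : x ≤ y) : delta M a (ρ x) / (ρ y ^ 2 + a ^ 2) * (y - x) ≤ ρ y - ρ x := by
  set c := delta M a (ρ x) / (ρ y ^ 2 + a ^ 2) with hc
  set g : ℝ → ℝ := fun s ↦ ρ s - c * s with hg
  have hderiv : ∀ s, HasDerivAt g (delta M a (ρ s) / (ρ s ^ 2 + a ^ 2) - c) s := fun s ↦
    (hρ.hasDerivAt s).sub ((hasDerivAt_id s).const_mul c |>.congr_deriv (by simp))
  have hmono : MonotoneOn g (Icc x y) := by
    refine monotoneOn_of_hasDerivWithinAt_nonneg (convex_Icc x y)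
      (fun s _ ↦ (hderiv s).continuousAt.continuousWithinAt)
      (fun s _ ↦ (hderiv s).hasDerivWithinAt) fun s hs ↦ ?_
    rw [interior_Icc] at hs
    have h1 : delta M a (ρ x) ≤ delta M a (ρ s) :=
      delta_le_delta hMa (hρ.rPlus_lt x).le ((hρ.strictMono hMa).monotone hs.1.le)
    have h2 : ρ s ^ 2 + a ^ 2 ≤ ρ y ^ 2 + a ^ 2 := by
      have := (hρ.strictMono hMa).monotone hs.2.le
      nlinarith [hρ.pos hMa s]
    have hA : 0 < ρ s ^ 2 + a ^ 2 := hρ.sq_add_sq_pos hMa s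
    have hAy : 0 < ρ y ^ 2 + a ^ 2 := hρ.sq_add_sq_pos hMa y
    have hΔ : 0 ≤ delta M a (ρ x) := delta_nonneg (le_of_lt hMa) (hρ.rPlus_lt x).le
    rw [sub_nonneg, hc]
    calc delta M a (ρ x) / (ρ y ^ 2 + a ^ 2) ≤ delta M a (ρ x) / (ρ s ^ 2 + a ^ 2) :=
          div_le_div_of_nonneg_left hΔ hA h2
      _ ≤ delta M a (ρ s) / (ρ s ^ 2 + a ^ 2) := div_le_div_of_nonneg_right h1 hA.le
  have hgxy : g x ≤ g y := hmono (left_mem_Icc.2 hxy) (right_mem_Icc.2 hxy) hxy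
  simp only [hg] at hgxy
  linarith

/-- **Upper comparison of radial and tortoise distances**: for a tortoise radius `ρ` and `x ≤ y`,
`ρ y − ρ x ≤ Δ(ρ y)/(ρ x² + a²)·(y − x)`. [cite: DafermosRodnianskiShlapentokhrothman2014, §2.1.2] -/
theorem sub_le_mul_sub' (hρ : IsTortoiseRadius M a ρ) (hMa : IsSubextremal M a) {x y : ℝ}
    (hxy : x ≤ y) : ρ y - ρ x ≤ delta M a (ρ y) / (ρ x ^ 2 + a ^ 2) * (y - x) := by
  set c := delta M a (ρ y) / (ρ x ^ 2 + a ^ 2) with hc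
  set g : ℝ → ℝ := fun s ↦ c * s - ρ s with hg
  have hderiv : ∀ s, HasDerivAt g (c - delta M a (ρ s) / (ρ s ^ 2 + a ^ 2)) s := fun s ↦
    ((hasDerivAt_id s).const_mul c |>.congr_deriv (by simp)).sub (hρ.hasDerivAt s)
  have hmono : MonotoneOn g (Icc x y) := by
    refine monotoneOn_of_hasDerivWithinAt_nonneg (convex_Icc x y)
      (fun s _ ↦ (hderiv s).continuousAt.continuousWithinAt)
      (fun s _ ↦ (hderiv s).hasDerivWithinAt) fun s hs ↦ ?_
    rw [interior_Icc] at hs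
    have h1 : delta M a (ρ s) ≤ delta M a (ρ y) :=
      delta_le_delta hMa (hρ.rPlus_lt s).le ((hρ.strictMono hMa).monotone hs.2.le)
    have h2 : ρ x ^ 2 + a ^ 2 ≤ ρ s ^ 2 + a ^ 2 := by
      have := (hρ.strictMono hMa).monotone hs.1.le
      nlinarith [hρ.pos hMa x]
    have hA : 0 < ρ s ^ 2 + a ^ 2 := hρ.sq_add_sq_pos hMa s
    have hAx : 0 < ρ x ^ 2 + a ^ 2 := hρ.sq_add_sq_pos hMa x
    have hΔ : 0 ≤ delta M a (ρ y) := delta_nonneg (le_of_lt hMa) (hρ.rPlus_lt y).le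
    have hΔs : 0 ≤ delta M a (ρ s) := delta_nonneg (le_of_lt hMa) (hρ.rPlus_lt s).le
    rw [sub_nonneg, hc]
    calc delta M a (ρ s) / (ρ s ^ 2 + a ^ 2) ≤ delta M a (ρ s) / (ρ x ^ 2 + a ^ 2) :=
          div_le_div_of_nonneg_left hΔs hAx h2
      _ ≤ delta M a (ρ y) / (ρ x ^ 2 + a ^ 2) := div_le_div_of_nonneg_right h1 hAx.le
  have hgxy : g x ≤ g y := hmono (left_mem_Icc.2 hxy) (right_mem_Icc.2 hxy) hxy
  simp only [hg] at hgxy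
  linarith

end IsTortoiseRadius

/-! ### Affine bounds in the tortoise variable -/

section Tortoise

variable {M a ω Λ : ℝ} {m : ℤ} {ρ : ℝ → ℝ}

set_option maxHeartbeats 400000 in
-- the two halves share a long common preamble; kept as one declaration
/-- **Affine two-sided control of Carter's coefficient before the threshold turning point, tortoise
variable.** Let `ρ` be a tortoise radius of a sub-extremal Kerr exterior, `ω = mω₊ ≠ 0`,
`J(r_t) = 0` with `r_t − r₊ ≥ r₊ − r₋` (`J` the threshold profile), `V(ρ b₂) = ω²`, and
`r_lo := ρ s_lo`, `r_b := ρ b₂`. Then for every `s ∈ [s_lo, b₂]`: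
`c₁(b₂ − s) − e₁ ≤ V(ρ s) − ω² ≤ c₂(b₂ − s) + e₂`, where
`c₁ = 2ω²(r_lo + r₊)h(r_lo)Δ(r_lo)²/(r_b² + a²)³`, `e₁ = Δ(r_b)(6(r_b + r₊)/(r_t + r₊) + 3)/(r_lo² + a²)²`,
`c₂ = ω²(2(r_t + r₊) + (r_t + r₊)²/(r_lo − r₋))Δ(r_b)²/(r_lo² + a²)³`, `e₂ = 3Δ(r_b)/(r_lo² + a²)²`.
[folklore] -/
theorem negCoeff_affine_bounds_tortoise_of_threshold (hρ : IsTortoiseRadius M a ρ)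
    (hMa : IsSubextremal M a) (hωth : ω = m * horizonAngularVelocity M a) (hω : ω ≠ 0) {rt : ℝ}
    (hrt : rPlus M a < rt) (hrtd : rPlus M a - rMinus M a ≤ rt - rPlus M a)
    (hJrt : Λ - 2 * a * m * ω - ω ^ 2 * (rt + rPlus M a) ^ 2 * ((rt - rPlus M a) / (rt - rMinus M a)) = 0)
    {b₂ slo : ℝ} (hV : sepPotential M a ω m Λ (ρ b₂) = ω ^ 2) {s : ℝ} (hs : s ∈ Icc slo b₂) :
    2 * ω ^ 2 * (ρ slo + rPlus M a) * ((ρ slo - rPlus M a) / (ρ slo - rMinus M a)) *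
          delta M a (ρ slo) ^ 2 / (ρ b₂ ^ 2 + a ^ 2) ^ 3 * (b₂ - s) -
        delta M a (ρ b₂) * (6 * (ρ b₂ + rPlus M a) / (rt + rPlus M a) + 3) / (ρ slo ^ 2 + a ^ 2) ^ 2 ≤
      sepPotential M a ω m Λ (ρ s) - ω ^ 2 ∧
    sepPotential M a ω m Λ (ρ s) - ω ^ 2 ≤
      ω ^ 2 * (2 * (rt + rPlus M a) + (rt + rPlus M a) ^ 2 / (ρ slo - rMinus M a)) *
          delta M a (ρ b₂) ^ 2 / (ρ slo ^ 2 + a ^ 2) ^ 3 * (b₂ - s) +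
        3 * delta M a (ρ b₂) / (ρ slo ^ 2 + a ^ 2) ^ 2 := by
  have ha : |a| < M := hMa
  have hM : 0 < M := hMa.pos
  have hrp : 0 < rPlus M a := rPlus_pos hM a
  have hd0 : 0 < rPlus M a - rMinus M a := sub_pos.2 hMa.rMinus_lt_rPlus
  set r := ρ s with hrdef
  set rlo := ρ slo with hrlo
  set rb := ρ b₂ with hrb
  have hr : rPlus M a < r := hρ.rPlus_lt s
  have hrlop : rPlus M a < rlo := hρ.rPlus_lt slo
  have hrbp : rPlus M a < rb := hρ.rPlus_lt b₂
  have hlor : rlo ≤ r := (hρ.strictMono hMa).monotone hs.1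
  have hrrb : r ≤ rb := (hρ.strictMono hMa).monotone hs.2
  have hr0 : 0 < r := hrp.trans hr
  have hrlo0 : 0 < rlo := hrp.trans hrlop
  have hrb0 : 0 < rb := hrp.trans hrbp
  have hA : 0 < r ^ 2 + a ^ 2 := by positivity
  have hAlo : 0 < rlo ^ 2 + a ^ 2 := by positivity
  have hAb : 0 < rb ^ 2 + a ^ 2 := by positivity
  have hAlor : rlo ^ 2 + a ^ 2 ≤ r ^ 2 + a ^ 2 := by nlinarith only [hlor, hrlo0]
  have hArb : r ^ 2 + a ^ 2 ≤ rb ^ 2 + a ^ 2 := by nlinarith only [hrrb, hr0]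
  have hΔr : 0 ≤ delta M a r := delta_nonneg ha.le hr.le
  have hΔlo : 0 ≤ delta M a rlo := delta_nonneg ha.le hrlop.le
  have hΔb : 0 ≤ delta M a rb := delta_nonneg ha.le hrbp.le
  have hΔlor : delta M a rlo ≤ delta M a r := IsTortoiseRadius.delta_le_delta hMa hrlop.le hlor
  have hΔrb : delta M a r ≤ delta M a rb := IsTortoiseRadius.delta_le_delta hMa hr.le hrrb
  have hrm : 0 < r - rMinus M a := by linarith only [hMa.rMinus_lt_rPlus, hr]
  have hrlom : 0 < rlo - rMinus M a := by linarith only [hMa.rMinus_lt_rPlus, hrlop]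
  have hω2 : 0 < ω ^ 2 := by positivity
  -- the radial affine bounds and the turning-radius facts
  obtain ⟨hlow, hup⟩ := sq_mul_negCoeff_affine_bounds_of_threshold (Λ := Λ) ha hωth hω hrt hrtd hJrt
    hrbp hV hr hrrb
  obtain ⟨-, -, hrtb, h3⟩ := thresholdProfile_turningRadius_le (Λ := Λ) ha hωth hω hrt hrtd hJrt hrbp hV
  have hrtp0 : 0 < rt + rPlus M a := by linarith only [hrt, hrp]
  -- radial vs tortoise distances on `[s, b₂]`
  have hdist₁ : delta M a r / (rb ^ 2 + a ^ 2) * (b₂ - s) ≤ rb - r := hρ.mul_sub_le_sub hMa hs.2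
  have hdist₂ : rb - r ≤ delta M a rb / (r ^ 2 + a ^ 2) * (b₂ - s) := hρ.sub_le_mul_sub' hMa hs.2
  have hbs : 0 ≤ b₂ - s := sub_nonneg.2 hs.2
  -- `h(r) ≥ h(r_lo)`, both in `[0, 1]`
  have hh0 : 0 ≤ (rlo - rPlus M a) / (rlo - rMinus M a) :=
    div_nonneg (by linarith only [hrlop]) hrlom.le
  have hhr0 : 0 ≤ (r - rPlus M a) / (r - rMinus M a) := div_nonneg (by linarith only [hr]) hrm.le
  have hhmono : (rlo - rPlus M a) / (rlo - rMinus M a) ≤ (r - rPlus M a) / (r - rMinus M a) := by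
    rw [div_le_div_iff₀ hrlom hrm]
    nlinarith [mul_nonneg (sub_nonneg.2 hlor) hd0.le]
  have hhr1 : (r - rPlus M a) / (r - rMinus M a) ≤ 1 := by
    rw [div_le_one hrm]; linarith only [hMa.rMinus_lt_rPlus]
  -- abbreviations
  set A := r ^ 2 + a ^ 2 with hAdef
  set Alo := rlo ^ 2 + a ^ 2 with hAlodef
  set Ab := rb ^ 2 + a ^ 2 with hAbdef
  set k := 2 * ω ^ 2 * (r + rPlus M a) * ((r - rPlus M a) / (r - rMinus M a)) with hkdef
  set klo := 2 * ω ^ 2 * (rlo + rPlus M a) * ((rlo - rPlus M a) / (rlo - rMinus M a)) with hklodef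
  set C := ω ^ 2 * (2 * (rt + rPlus M a) + (rt + rPlus M a) ^ 2 / (rlo - rMinus M a)) with hCdef
  set Cr := ω ^ 2 * (2 * (rt + rPlus M a) + (rt + rPlus M a) ^ 2 / (r - rMinus M a)) with hCrdef
  set E := 6 * (rb + rPlus M a) / (rt + rPlus M a) with hEdef
  set qv := sepPotential M a ω m Λ r - ω ^ 2 with hqv
  have hA2 : 0 < A ^ 2 := by positivity
  have hk0 : 0 ≤ k := mul_nonneg (mul_nonneg (by positivity) (by linarith only [hr0, hrp])) hhr0
  have hklo0 : 0 ≤ klo :=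
    mul_nonneg (mul_nonneg (by positivity) (by linarith only [hrlo0, hrp])) hh0
  have hklok : klo ≤ k := by
    rw [hklodef, hkdef]
    have h1 : (rlo + rPlus M a) * ((rlo - rPlus M a) / (rlo - rMinus M a)) ≤
        (r + rPlus M a) * ((r - rPlus M a) / (r - rMinus M a)) :=
      mul_le_mul (by linarith only [hlor]) hhmono hh0 (by linarith only [hr0, hrp])
    have h2 := mul_le_mul_of_nonneg_left h1 (by positivity : (0:ℝ) ≤ 2 * ω ^ 2)
    calc 2 * ω ^ 2 * (rlo + rPlus M a) * ((rlo - rPlus M a) / (rlo - rMinus M a))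
        = 2 * ω ^ 2 * ((rlo + rPlus M a) * ((rlo - rPlus M a) / (rlo - rMinus M a))) := by ring
      _ ≤ 2 * ω ^ 2 * ((r + rPlus M a) * ((r - rPlus M a) / (r - rMinus M a))) := h2
      _ = 2 * ω ^ 2 * (r + rPlus M a) * ((r - rPlus M a) / (r - rMinus M a)) := by ring
  have hE0 : 0 ≤ E := div_nonneg (by linarith only [hrb0, hrp]) hrtp0.le
  have hC0 : 0 ≤ C :=
    mul_nonneg hω2.le (add_nonneg (by linarith only [hrtp0]) (div_nonneg (sq_nonneg _) hrlom.le))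
  have hCrC : Cr ≤ C := by
    rw [hCrdef, hCdef]
    refine mul_le_mul_of_nonneg_left ?_ hω2.le
    have : (rt + rPlus M a) ^ 2 / (r - rMinus M a) ≤ (rt + rPlus M a) ^ 2 / (rlo - rMinus M a) :=
      div_le_div_of_nonneg_left (sq_nonneg _) hrlom (by linarith only [hlor])
    linarith only [this]
  -- powers of the denominators compared
  have hA2b : A ^ 2 / Ab ^ 3 ≤ 1 / Ab := by
    rw [div_le_div_iff₀ (by positivity) hAb, one_mul]
    have : A ^ 2 ≤ Ab ^ 2 := pow_le_pow_left₀ hA.le hArb 2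
    calc A ^ 2 * Ab ≤ Ab ^ 2 * Ab := mul_le_mul_of_nonneg_right this hAb.le
      _ = Ab ^ 3 := by ring
  have hA2lo : 1 ≤ A ^ 2 / Alo ^ 2 := by
    rw [one_le_div (by positivity)]; exact pow_le_pow_left₀ hAlo.le hAlor 2
  have hA3lo : 1 / A ≤ A ^ 2 / Alo ^ 3 := by
    rw [div_le_div_iff₀ hA (by positivity), one_mul]
    calc Alo ^ 3 ≤ A ^ 3 := pow_le_pow_left₀ hAlo.le hAlor 3
      _ = A ^ 2 * A := by ring
  constructor
  · -- LOWER: `A²·qv ≥ Δ(r)(k(r_t − r) − 3)`, `r_t − r ≥ X − 3/(ω²(r_t+r₊))`, `X = Δ(b₂−s)/Ab ≤ r_b − r`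
    set X := delta M a r / Ab * (b₂ - s) with hXdef
    have hX0 : 0 ≤ X := mul_nonneg (div_nonneg hΔr hAb.le) hbs
    have hrbrt : rb - rt ≤ 3 / (ω ^ 2 * (rt + rPlus M a)) := by
      rw [le_div_iff₀ (by positivity)]; linarith only [h3]
    have hrt_r : X - 3 / (ω ^ 2 * (rt + rPlus M a)) ≤ rt - r := by linarith only [hdist₁, hrbrt]
    have hk3 : k * (3 / (ω ^ 2 * (rt + rPlus M a))) ≤ E := by
      have e : k * (3 / (ω ^ 2 * (rt + rPlus M a))) =
          6 * ((r + rPlus M a) * ((r - rPlus M a) / (r - rMinus M a))) / (rt + rPlus M a) := by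
        rw [hkdef]; field_simp; ring
      rw [e, hEdef, div_le_div_iff_of_pos_right hrtp0]
      have : (r + rPlus M a) * ((r - rPlus M a) / (r - rMinus M a)) ≤ (rb + rPlus M a) * 1 :=
        mul_le_mul (by linarith only [hrrb]) hhr1 hhr0 (by linarith only [hrb0, hrp])
      linarith only [this]
    have hJlow : k * X - E - 3 ≤ k * (rt - r) - 3 := by
      have := mul_le_mul_of_nonneg_left hrt_r hk0
      rw [mul_sub] at this
      linarith only [this, hk3]
    have hmain : delta M a r * (k * X - E - 3) ≤ A ^ 2 * qv :=
      (mul_le_mul_of_nonneg_left hJlow hΔr).trans hlow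
    -- `A²·c₁(b₂−s) ≤ Δ·k·X`
    have p1 : A ^ 2 * (klo * delta M a rlo ^ 2 / Ab ^ 3 * (b₂ - s)) ≤ delta M a r * (k * X) := by
      have e1 : A ^ 2 * (klo * delta M a rlo ^ 2 / Ab ^ 3 * (b₂ - s)) =
          klo * delta M a rlo ^ 2 * (b₂ - s) * (A ^ 2 / Ab ^ 3) := by ring
      have e2 : delta M a r * (k * X) = k * delta M a r ^ 2 * (b₂ - s) * (1 / Ab) := by
        rw [hXdef]; ring
      rw [e1, e2]
      have f2 : klo * delta M a rlo ^ 2 * (b₂ - s) ≤ k * delta M a r ^ 2 * (b₂ - s) := by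
        apply mul_le_mul_of_nonneg_right _ hbs
        exact mul_le_mul hklok (pow_le_pow_left₀ hΔlo hΔlor 2) (sq_nonneg _) hk0
      exact mul_le_mul f2 hA2b (by positivity) (by positivity)
    -- `Δ·(E + 3) ≤ A²·e₁`
    have p2 : delta M a r * (E + 3) ≤ A ^ 2 * (delta M a rb * (E + 3) / Alo ^ 2) := by
      have e2 : A ^ 2 * (delta M a rb * (E + 3) / Alo ^ 2) = delta M a rb * (E + 3) * (A ^ 2 / Alo ^ 2) := by
        ring
      rw [e2]
      calc delta M a r * (E + 3) = delta M a r * (E + 3) * 1 := (mul_one _).symm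
        _ ≤ delta M a rb * (E + 3) * (A ^ 2 / Alo ^ 2) :=
            mul_le_mul (mul_le_mul_of_nonneg_right hΔrb (by linarith only [hE0])) hA2lo zero_le_one
              (mul_nonneg hΔb (by linarith only [hE0]))
    have hfin : A ^ 2 * (klo * delta M a rlo ^ 2 / Ab ^ 3 * (b₂ - s) - delta M a rb * (E + 3) / Alo ^ 2) ≤
        A ^ 2 * qv := by
      have e : delta M a r * (k * X - E - 3) = delta M a r * (k * X) - delta M a r * (E + 3) := by ring
      rw [e] at hmain
      rw [mul_sub]
      linarith only [hmain, p1, p2]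
    exact le_of_mul_le_mul_left hfin hA2
  · -- UPPER: `A²·qv ≤ Δ(r)(Cr(r_b − r) + 3)`, `r_b − r ≤ Y = Δb(b₂−s)/A`, `Cr ≤ C`
    set Y := delta M a rb / A * (b₂ - s) with hYdef
    have hY0 : 0 ≤ Y := mul_nonneg (div_nonneg hΔb hA.le) hbs
    have hJup : Cr * (rb - r) + 3 ≤ C * Y + 3 := by
      have hCr0 : 0 ≤ Cr :=
        mul_nonneg hω2.le (add_nonneg (by linarith only [hrtp0]) (div_nonneg (sq_nonneg _) hrm.le))
      have := mul_le_mul hCrC hdist₂ (by linarith only [hrrb]) hC0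
      linarith only [this]
    have hmain : A ^ 2 * qv ≤ delta M a r * (C * Y + 3) := hup.trans (mul_le_mul_of_nonneg_left hJup hΔr)
    -- `Δ·C·Y ≤ A²·c₂(b₂−s)`
    have q1 : delta M a r * (C * Y) ≤ A ^ 2 * (C * delta M a rb ^ 2 / Alo ^ 3 * (b₂ - s)) := by
      have e1 : delta M a r * (C * Y) = C * (delta M a r * delta M a rb) * (b₂ - s) * (1 / A) := by
        rw [hYdef]; ring
      have e2 : A ^ 2 * (C * delta M a rb ^ 2 / Alo ^ 3 * (b₂ - s)) =
          C * (delta M a rb * delta M a rb) * (b₂ - s) * (A ^ 2 / Alo ^ 3) := by ring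
      rw [e1, e2]
      have f1 : C * (delta M a r * delta M a rb) * (b₂ - s) ≤ C * (delta M a rb * delta M a rb) * (b₂ - s) := by
        apply mul_le_mul_of_nonneg_right _ hbs
        exact mul_le_mul_of_nonneg_left (mul_le_mul_of_nonneg_right hΔrb hΔb) hC0
      exact mul_le_mul f1 hA3lo (by positivity) (by positivity)
    -- `3Δ ≤ A²·e₂`
    have q2 : delta M a r * 3 ≤ A ^ 2 * (3 * delta M a rb / Alo ^ 2) := by
      have e2 : A ^ 2 * (3 * delta M a rb / Alo ^ 2) = 3 * delta M a rb * (A ^ 2 / Alo ^ 2) := by ring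
      rw [e2]
      calc delta M a r * 3 = 3 * delta M a r * 1 := by ring
        _ ≤ 3 * delta M a rb * (A ^ 2 / Alo ^ 2) :=
            mul_le_mul (by linarith only [hΔrb]) hA2lo zero_le_one (by positivity)
    have hfin : A ^ 2 * qv ≤ A ^ 2 * (C * delta M a rb ^ 2 / Alo ^ 3 * (b₂ - s) + 3 * delta M a rb / Alo ^ 2) := by
      rw [mul_add]
      have e : delta M a r * (C * Y + 3) = delta M a r * (C * Y) + delta M a r * 3 := by ring
      rw [e] at hmain
      linarith only [hmain, q1, q2]
    exact le_of_mul_le_mul_left hfin hA2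

end Tortoise

end Kerr

end Literature.Geometry.Lorentzian

end
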